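import Mathlib
import HarnessLib
import Summits.NavierStokesRegularity.NavierStokesRegularity.Theorems.TypeIQuarterGateScarEnvelopeTypeIFinalTrace

/-!
# TypeIQuarterGate · crux `ScarEnvelopeTypeI` (stmt-NavierStokesRegularity-23843, H3) — the FINAL TRACE of an
# Albritton–Barker object, part 2: the kernel-checked BRIDGE between the distributional final trace and the pointwise
# final slice (critic V10-P2 / V11-P3 «ONE trace vocabulary»)

LANDING (director-ns #258 = KEY-NS #153 (h); critic of record ns-wall-crit-1 g0 GO 2026-08-28T19:11:20Z).  From
`Cruxes/ScarEnvelopeTypeI/FinalTraceSketch.lean` v2 §6 (author ns-idea-18 g4, sha16 1f1d3519193d1a55) BY NAME, texts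
VERBATIM (namespace `…Cruxes.ScarEnvelopeTypeI.FinalTrace`, `section Bridge`; local notation `E3` spelled out):
`finalTime_neBot`, `SlicesLocallyBddOn` (+ `.mono`, `slicesLocallyBddOn_of_hasTypeIDecay`),
`eventually_aestronglyMeasurable_of_abTower`, `tendsto_slicePairing_of_hasFinalSlice`, `traceEssBddOn_of_hasFinalSlice_bdd`,
`hasZeroTraceOn_of_hasFinalSlice_ae_zero`, `aestronglyMeasurable_of_hasFinalSlice`, `norm_slice_le_of_hasFinalSlice`,
`hasFinalSlice_ae_zero_of_hasZeroTraceOn`, and the A–B instantiations `traceEssBddOn_of_hasFinalSlice_AB`,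
`hasZeroTraceOn_of_hasFinalSlice_AB`, `hasFinalSlice_ae_zero_of_hasZeroTraceOn_AB` — all PROVED, no open `Prop`
consumed (`regPt_of_hasFinalSlice_bdd_of_fdc`, which consumes the open target `FinalDatumCriterionAB`, is NOT landed).
The hypothesis `hsl` of every lemma is the definiens of `ZoomDictionary.TerminalLayer.HasFinalSlice U u₀` (part 1), so
each applies to the named predicate by `Iff.rfl`.  Filed `--supports stmt-NavierStokesRegularity-23843 --as helper` by an
idle prover hand (seat ns-ffc-k1 g7) for the LEAD-23843 lineage.  Bridge lemmas only — NOT the crux; Navier–Stokes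
regularity is NOT proved; nothing below touches 23843, (E1⁺), H₂ or any Liouville statement.
[cite: AlbrittonBarker2019, §2 (the class)]
-/

set_option linter.dupNamespace false

open MeasureTheory Set Metric Filter Topology
open scoped ENNReal RealInnerProductSpace

namespace Summit.NavierStokesRegularity.NavierStokesRegularity.Cruxes.ScarEnvelopeTypeI.FinalTrace

open Literature.Analysis.FluidPDE
open Summit.NavierStokesRegularity.NavierStokesRegularity.Cruxes.ScarEnvelopeTypeI.ZoomDictionary

/-! ## 6. ONE trace vocabulary — bridge to the pointwise final slice (V10 P2; kernel-checked)

`ZoomDictionary.TerminalLayer.HasFinalSlice U u₀` (ns-idea-17 g3, `Cruxes/…/TerminalLayerSketch.lean`)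
is BY DEFINITION `∀ x, x ≠ 0 → Tendsto (fun t => U t x) (𝓝[<] 0) (𝓝 (u₀ x))`.  The lemmas below take
exactly that formula as the hypothesis `hsl`, so they apply to `HasFinalSlice` by `Iff.rfl` while this
file stays independent of the (unbuilt) sketch module; the landing module states them over the one
named predicate.  Setting: a set `S` off the origin on which the live slices are locally uniformly
bounded near the final time (`SlicesLocallyBddOn`; automatic under the envelope `HasTypeIDecay` —
`slicesLocallyBddOn_of_hasTypeIDecay` — which is a standing hypothesis of every terminal-layer
statement), slices eventually a.e.-strongly measurable (automatic for A–B objects, continuous on the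
open past — `eventually_aestronglyMeasurable_of_abTower`).  Then:
* `tendsto_slicePairing_of_hasFinalSlice` — TRACE = SLICE as distributions on `S`;
* `traceEssBddOn_of_hasFinalSlice_bdd` — slice (a.e.-)bounded by `B` on `S` ⇒ `TraceEssBddOn U S B`;
* `hasZeroTraceOn_of_hasFinalSlice_ae_zero` — slice `= 0` a.e. on `S` ⇒ `HasZeroTraceOn U S`;
* `hasFinalSlice_ae_zero_of_hasZeroTraceOn` — conversely, zero trace on an OPEN `S` ⇒ slice `= 0`
  a.e. on `S` (fundamental lemma; the slice is a.e.-strongly measurable and locally bounded, proved);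
and the A–B instantiations `…_AB` under `ABTower M U P H ∧ HasTypeIDecay A U` (the terminal-layer
package's standing hypotheses), which make the two g3 packages compose by one-line applications. -/

section Bridge

variable {U : ℝ → (EuclideanSpace ℝ (Fin 3)) → (EuclideanSpace ℝ (Fin 3))} {u₀ : (EuclideanSpace ℝ (Fin 3)) → (EuclideanSpace ℝ (Fin 3))}

/-- Values off the topological support vanish. -/
private theorem apply_eq_zero_of_not_mem_tsupport {φ : (EuclideanSpace ℝ (Fin 3)) → (EuclideanSpace ℝ (Fin 3))} {x : (EuclideanSpace ℝ (Fin 3))} (hx : x ∉ tsupport φ) :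
    φ x = 0 := by
  by_contra hne
  exact hx (subset_tsupport φ (Function.mem_support.2 hne))

/-- The essential final-time filter is non-trivial: a left-neighbourhood of `0` is never
Lebesgue-null.  (Needed for uniqueness of essential limits.) -/
theorem finalTime_neBot : (finalTime).NeBot := by
  rw [finalTime, Filter.inf_neBot_iff]
  intro s hs t ht
  by_contra hst
  rw [Set.not_nonempty_iff_eq_empty] at hst
  obtain ⟨l, hl, hls⟩ := mem_nhdsLT_iff_exists_Ioo_subset.1 hs
  have hl0 : l < 0 := hl
  have hsub : Ioo l 0 ⊆ tᶜ := fun x hx hxt => by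
    have hmem : x ∈ s ∩ t := ⟨hls hx, hxt⟩
    rw [hst] at hmem
    exact hmem
  have h0 : (volume : Measure ℝ) (Ioo l 0) = 0 := measure_mono_null hsub (mem_ae_iff.1 ht)
  rw [Real.volume_Ioo] at h0
  have : (0 : ℝ) - l ≤ 0 := ENNReal.ofReal_eq_zero.1 h0
  linarith

/-- LOCAL UNIFORM BOUNDEDNESS of the live slices near the final time on `S`: every compact part of `S`
carries one bound valid at all times of some left-neighbourhood of `0`. -/
def SlicesLocallyBddOn (U : ℝ → (EuclideanSpace ℝ (Fin 3)) → (EuclideanSpace ℝ (Fin 3))) (S : Set (EuclideanSpace ℝ (Fin 3))) : Prop :=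
  ∀ K : Set (EuclideanSpace ℝ (Fin 3)), IsCompact K → K ⊆ S → ∃ C : ℝ, ∀ᶠ s in 𝓝[<] (0 : ℝ), ∀ x ∈ K, ‖U s x‖ ≤ C

/-- Monotonicity of `SlicesLocallyBddOn` in the set. -/
theorem SlicesLocallyBddOn.mono {S S' : Set (EuclideanSpace ℝ (Fin 3))} (h : SlicesLocallyBddOn U S) (hS : S' ⊆ S) :
    SlicesLocallyBddOn U S' :=
  fun K hK hKS => h K hK (hKS.trans hS)

/-- The Type-I ENVELOPE gives local uniform bounds off the origin:
`‖U(t,x)‖ ≤ A/(‖x‖ + √(-t)) ≤ |A|/‖x‖ ≤ |A|/dist(K,0)`. -/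
theorem slicesLocallyBddOn_of_hasTypeIDecay {A : ℝ} (h : HasTypeIDecay A U) :
    SlicesLocallyBddOn U ({0}ᶜ : Set (EuclideanSpace ℝ (Fin 3))) := by
  intro K hK hK0
  rcases K.eq_empty_or_nonempty with rfl | hne
  · exact ⟨0, Filter.Eventually.of_forall fun s x hx => (Set.notMem_empty x hx).elim⟩
  obtain ⟨x₀, hx₀K, hx₀⟩ := hK.exists_isMinOn hne continuous_norm.continuousOn
  have hx₀0 : x₀ ≠ 0 := by simpa using hK0 hx₀K
  have hδ : 0 < ‖x₀‖ := norm_pos_iff.2 hx₀0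
  refine ⟨|A| / ‖x₀‖, ?_⟩
  filter_upwards [self_mem_nhdsWithin] with s hs x hx
  have hs0 : s < 0 := hs
  have hxx : ‖x₀‖ ≤ ‖x‖ := (isMinOn_iff.1 hx₀) x hx
  have hxpos : 0 < ‖x‖ := lt_of_lt_of_le hδ hxx
  have hden : 0 < ‖x‖ + Real.sqrt (-s) := by positivity
  calc ‖U s x‖ ≤ A / (‖x‖ + Real.sqrt (-s)) := h s hs0 x
    _ ≤ |A| / (‖x‖ + Real.sqrt (-s)) := div_le_div_of_nonneg_right (le_abs_self A) hden.le
    _ ≤ |A| / ‖x‖ :=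
        div_le_div_of_nonneg_left (abs_nonneg A) hxpos (by linarith [Real.sqrt_nonneg (-s)])
    _ ≤ |A| / ‖x₀‖ := div_le_div_of_nonneg_left (abs_nonneg A) hδ hxx

/-- Slices of an A–B object are eventually (indeed for every `s < 0`) continuous, hence
a.e.-strongly measurable. -/
theorem eventually_aestronglyMeasurable_of_abTower {M : ℝ} {P : ℝ → (EuclideanSpace ℝ (Fin 3)) → ℝ}
    {H : ℝ → (EuclideanSpace ℝ (Fin 3)) → (EuclideanSpace ℝ (Fin 3)) →L[ℝ] (EuclideanSpace ℝ (Fin 3))} (hAB : ABTower M U P H) :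
    ∀ᶠ s in 𝓝[<] (0 : ℝ), AEStronglyMeasurable (U s) (volume : Measure (EuclideanSpace ℝ (Fin 3))) := by
  have hcont : ContinuousOn (Function.uncurry U) (Iio 0 ×ˢ univ) := (towerObj_of_abTower hAB).2.1
  filter_upwards [self_mem_nhdsWithin] with s hs
  have hs0 : s < 0 := hs
  have hΨ : Continuous (fun x : (EuclideanSpace ℝ (Fin 3)) => (s, x)) := by fun_prop
  have hmaps : ∀ x : (EuclideanSpace ℝ (Fin 3)), (s, x) ∈ Iio (0 : ℝ) ×ˢ (univ : Set (EuclideanSpace ℝ (Fin 3))) := fun x => ⟨hs0, mem_univ _⟩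
  exact ((hcont.comp_continuous hΨ hmaps).congr fun x => rfl).aestronglyMeasurable

/-- **TRACE = SLICE (distributionally).**  If `U(t,x) → u₀(x)` as `t → 0⁻` for every `x ≠ 0`
(`= TerminalLayer.HasFinalSlice U u₀`), the slices are eventually a.e.-strongly measurable and
locally uniformly bounded near the final time on `S ⊆ ℝ³ ∖ {0}`, then for every test field on `S`
the slice pairing converges to the pairing with `u₀`:  `⟨U(s), φ⟩ → ⟨u₀, φ⟩` as `s → 0⁻`
(dominated convergence).  In particular the distributional final trace of this file, restricted to
`S`, is integration against the pointwise final slice of the terminal-layer package. -/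
theorem tendsto_slicePairing_of_hasFinalSlice {S : Set (EuclideanSpace ℝ (Fin 3))} (hS : S ⊆ {0}ᶜ)
    (hsl : ∀ x : (EuclideanSpace ℝ (Fin 3)), x ≠ 0 → Tendsto (fun t : ℝ => U t x) (𝓝[<] (0 : ℝ)) (𝓝 (u₀ x)))
    (hmeas : ∀ᶠ s in 𝓝[<] (0 : ℝ), AEStronglyMeasurable (U s) (volume : Measure (EuclideanSpace ℝ (Fin 3))))
    (hbd : SlicesLocallyBddOn U S) {φ : (EuclideanSpace ℝ (Fin 3)) → (EuclideanSpace ℝ (Fin 3))} (hφ : IsTestOn S φ) :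
    Tendsto (slicePairing U φ) (𝓝[<] (0 : ℝ)) (𝓝 (∫ x, ⟪u₀ x, φ x⟫)) := by
  obtain ⟨C, hC⟩ := hbd (tsupport φ) hφ.2.1 hφ.2.2
  show Tendsto (fun s => ∫ x, ⟪U s x, φ x⟫) (𝓝[<] (0 : ℝ)) (𝓝 (∫ x, ⟪u₀ x, φ x⟫))
  refine tendsto_integral_filter_of_dominated_convergence (fun x => C * ‖φ x‖) ?_ ?_ ?_ ?_
  · filter_upwards [hmeas] with s hs
    exact hs.inner hφ.1.aestronglyMeasurable
  · filter_upwards [hC] with s hs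
    refine Filter.Eventually.of_forall fun x => ?_
    by_cases hx : x ∈ tsupport φ
    · calc ‖⟪U s x, φ x⟫‖ ≤ ‖U s x‖ * ‖φ x‖ := norm_inner_le_norm _ _
        _ ≤ C * ‖φ x‖ := mul_le_mul_of_nonneg_right (hs x hx) (norm_nonneg _)
    · simp [apply_eq_zero_of_not_mem_tsupport hx]
  · exact ((hφ.1.integrable_of_hasCompactSupport hφ.2.1).norm).const_mul C
  · refine Filter.Eventually.of_forall fun x => ?_
    by_cases hx : x ∈ tsupport φ
    · have hx0 : x ≠ 0 := by simpa using hS (hφ.2.2 hx)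
      exact (hsl x hx0).inner tendsto_const_nhds
    · simp [apply_eq_zero_of_not_mem_tsupport hx]

/-- **Bounded slice ⇒ essentially bounded trace** (`traceEssBddOn_of_hasFinalSlice_bdd`, the lemma
the critic named): if the final slice is a.e. bounded by `B` on `S`, the final trace is essentially
bounded by `B` on `S`. -/
theorem traceEssBddOn_of_hasFinalSlice_bdd {S : Set (EuclideanSpace ℝ (Fin 3))} (hS : S ⊆ {0}ᶜ)
    (hsl : ∀ x : (EuclideanSpace ℝ (Fin 3)), x ≠ 0 → Tendsto (fun t : ℝ => U t x) (𝓝[<] (0 : ℝ)) (𝓝 (u₀ x)))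
    (hmeas : ∀ᶠ s in 𝓝[<] (0 : ℝ), AEStronglyMeasurable (U s) (volume : Measure (EuclideanSpace ℝ (Fin 3))))
    (hbd : SlicesLocallyBddOn U S) {B : ℝ}
    (hB : ∀ᵐ x ∂(volume : Measure (EuclideanSpace ℝ (Fin 3))), x ∈ S → ‖u₀ x‖ ≤ B) :
    TraceEssBddOn U S B := by
  intro φ hφ ε hε
  have hlim := tendsto_slicePairing_of_hasFinalSlice hS hsl hmeas hbd hφ
  have hint : Integrable (fun x => B * ‖φ x‖) (volume : Measure (EuclideanSpace ℝ (Fin 3))) :=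
    ((hφ.1.integrable_of_hasCompactSupport hφ.2.1).norm).const_mul B
  have hbound : ∀ᵐ x ∂(volume : Measure (EuclideanSpace ℝ (Fin 3))), ‖⟪u₀ x, φ x⟫‖ ≤ B * ‖φ x‖ := by
    filter_upwards [hB] with x hx
    by_cases hxS : x ∈ tsupport φ
    · calc ‖⟪u₀ x, φ x⟫‖ ≤ ‖u₀ x‖ * ‖φ x‖ := norm_inner_le_norm _ _
        _ ≤ B * ‖φ x‖ := mul_le_mul_of_nonneg_right (hx (hφ.2.2 hxS)) (norm_nonneg _)
    · simp [apply_eq_zero_of_not_mem_tsupport hxS]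
  have hle : ‖∫ x, ⟪u₀ x, φ x⟫‖ ≤ B * ∫ x, ‖φ x‖ := by
    have h := norm_integral_le_of_norm_le hint hbound
    rwa [integral_const_mul] at h
  have hev : ∀ᶠ s in 𝓝[<] (0 : ℝ), dist (slicePairing U φ s) (∫ x, ⟪u₀ x, φ x⟫) < ε :=
    (Metric.tendsto_nhds.1 hlim) ε hε
  refine Filter.Eventually.filter_mono (inf_le_left : finalTime ≤ 𝓝[<] (0 : ℝ)) ?_
  filter_upwards [hev] with s hs
  rw [Real.dist_eq] at hs
  have h1 := abs_sub_abs_le_abs_sub (slicePairing U φ s) (∫ x, ⟪u₀ x, φ x⟫)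
  have h2 : |∫ x, ⟪u₀ x, φ x⟫| ≤ B * ∫ x, ‖φ x‖ := by simpa only [Real.norm_eq_abs] using hle
  linarith

/-- **A.e.-zero slice ⇒ zero trace.** -/
theorem hasZeroTraceOn_of_hasFinalSlice_ae_zero {S : Set (EuclideanSpace ℝ (Fin 3))} (hS : S ⊆ {0}ᶜ)
    (hsl : ∀ x : (EuclideanSpace ℝ (Fin 3)), x ≠ 0 → Tendsto (fun t : ℝ => U t x) (𝓝[<] (0 : ℝ)) (𝓝 (u₀ x)))
    (hmeas : ∀ᶠ s in 𝓝[<] (0 : ℝ), AEStronglyMeasurable (U s) (volume : Measure (EuclideanSpace ℝ (Fin 3))))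
    (hbd : SlicesLocallyBddOn U S) (h0 : ∀ᵐ x ∂(volume : Measure (EuclideanSpace ℝ (Fin 3))), x ∈ S → u₀ x = 0) :
    HasZeroTraceOn U S := by
  intro φ hφ
  have hlim := tendsto_slicePairing_of_hasFinalSlice hS hsl hmeas hbd hφ
  have hI : ∫ x, ⟪u₀ x, φ x⟫ = (0 : ℝ) := by
    refine integral_eq_zero_of_ae ?_
    filter_upwards [h0] with x hx
    by_cases hxS : x ∈ tsupport φ
    · simp [hx (hφ.2.2 hxS)]
    · simp [apply_eq_zero_of_not_mem_tsupport hxS]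
  rw [hI] at hlim
  exact hlim.mono_left inf_le_left

/-- The pointwise final slice is a.e.-strongly measurable (limit along a sequence of measurable
slices; the exceptional point `0` is Lebesgue-null). -/
theorem aestronglyMeasurable_of_hasFinalSlice
    (hsl : ∀ x : (EuclideanSpace ℝ (Fin 3)), x ≠ 0 → Tendsto (fun t : ℝ => U t x) (𝓝[<] (0 : ℝ)) (𝓝 (u₀ x)))
    (hmeas : ∀ᶠ s in 𝓝[<] (0 : ℝ), AEStronglyMeasurable (U s) (volume : Measure (EuclideanSpace ℝ (Fin 3)))) :
    AEStronglyMeasurable u₀ (volume : Measure (EuclideanSpace ℝ (Fin 3))) := by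
  obtain ⟨ns, hns, hmeas'⟩ := exists_seq_forall_of_frequently hmeas.frequently
  refine aestronglyMeasurable_of_tendsto_ae atTop (f := fun n => U (ns n)) hmeas' ?_
  have h0 : ∀ᵐ x ∂(volume : Measure (EuclideanSpace ℝ (Fin 3))), x ∈ ({0}ᶜ : Set (EuclideanSpace ℝ (Fin 3))) :=
    compl_mem_ae_iff.2 (measure_singleton (0 : (EuclideanSpace ℝ (Fin 3))))
  filter_upwards [h0] with x hx
  have hx0 : x ≠ 0 := by simpa using hx
  exact (hsl x hx0).comp hns

/-- Off the origin, the pointwise final slice inherits the local uniform bounds of the live slices. -/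
theorem norm_slice_le_of_hasFinalSlice {K : Set (EuclideanSpace ℝ (Fin 3))} {C : ℝ}
    (hsl : ∀ x : (EuclideanSpace ℝ (Fin 3)), x ≠ 0 → Tendsto (fun t : ℝ => U t x) (𝓝[<] (0 : ℝ)) (𝓝 (u₀ x)))
    (hC : ∀ᶠ s in 𝓝[<] (0 : ℝ), ∀ x ∈ K, ‖U s x‖ ≤ C) {x : (EuclideanSpace ℝ (Fin 3))} (hx : x ∈ K) (hx0 : x ≠ 0) :
    ‖u₀ x‖ ≤ C :=
  le_of_tendsto (hsl x hx0).norm (hC.mono fun _ hs => hs x hx)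

/-- **Zero trace ⇒ a.e.-zero slice (slice = trace a.e. where both exist).**  On an OPEN set off the
origin with locally uniformly bounded slices, zero final trace forces the pointwise final slice to
vanish almost everywhere (uniqueness of essential limits on the non-trivial filter `finalTime`, local
integrability of the slice, and the fundamental lemma of the calculus of variations). -/
theorem hasFinalSlice_ae_zero_of_hasZeroTraceOn {S : Set (EuclideanSpace ℝ (Fin 3))} (hSo : IsOpen S) (hS : S ⊆ {0}ᶜ)
    (hsl : ∀ x : (EuclideanSpace ℝ (Fin 3)), x ≠ 0 → Tendsto (fun t : ℝ => U t x) (𝓝[<] (0 : ℝ)) (𝓝 (u₀ x)))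
    (hmeas : ∀ᶠ s in 𝓝[<] (0 : ℝ), AEStronglyMeasurable (U s) (volume : Measure (EuclideanSpace ℝ (Fin 3))))
    (hbd : SlicesLocallyBddOn U S) (hz : HasZeroTraceOn U S) :
    ∀ᵐ x ∂(volume : Measure (EuclideanSpace ℝ (Fin 3))), x ∈ S → u₀ x = 0 := by
  haveI : (finalTime).NeBot := finalTime_neBot
  -- (1) every test pairing of the slice vanishes
  have hpair : ∀ φ : (EuclideanSpace ℝ (Fin 3)) → (EuclideanSpace ℝ (Fin 3)), IsTestOn S φ → ∫ x, ⟪u₀ x, φ x⟫ = (0 : ℝ) := by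
    intro φ hφ
    have h1 : Tendsto (slicePairing U φ) finalTime (𝓝 (∫ x, ⟪u₀ x, φ x⟫)) :=
      (tendsto_slicePairing_of_hasFinalSlice hS hsl hmeas hbd hφ).mono_left inf_le_left
    have h2 : Tendsto (slicePairing U φ) finalTime (𝓝 0) := hz φ hφ
    exact tendsto_nhds_unique h1 h2
  -- (2) the slice is a.e.-strongly measurable and locally integrable on S
  have hu₀ : AEStronglyMeasurable u₀ (volume : Measure (EuclideanSpace ℝ (Fin 3))) :=
    aestronglyMeasurable_of_hasFinalSlice hsl hmeas
  have hloc : LocallyIntegrableOn u₀ S (volume : Measure (EuclideanSpace ℝ (Fin 3))) := by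
    intro x hx
    obtain ⟨r, hr, hrS⟩ := Metric.isOpen_iff.1 hSo x hx
    have hKS : closedBall x (r / 2) ⊆ S := (closedBall_subset_ball (by linarith)).trans hrS
    obtain ⟨C, hC⟩ := hbd (closedBall x (r / 2)) (isCompact_closedBall x (r / 2)) hKS
    refine ⟨closedBall x (r / 2), mem_nhdsWithin_of_mem_nhds (closedBall_mem_nhds x (by linarith)), ?_⟩
    refine Measure.integrableOn_of_bounded (M := C) measure_closedBall_lt_top.ne hu₀ ?_
    refine (ae_restrict_mem measurableSet_closedBall).mono fun y hy => ?_
    exact norm_slice_le_of_hasFinalSlice hsl hC hy (by simpa using hS (hKS hy))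
  -- (3) fundamental lemma, scalar smooth tests `g` and constant directions `c`
  refine hSo.ae_eq_zero_of_integral_contDiff_smul_eq_zero hloc fun g hg hgc hgS => ?_
  have hGint : Integrable (fun x => g x • u₀ x) (volume : Measure (EuclideanSpace ℝ (Fin 3))) := by
    obtain ⟨C, hC⟩ := hbd (tsupport g) hgc.isCompact hgS
    obtain ⟨Cg, hCg⟩ := hg.continuous.bounded_above_of_compact_support hgc
    have hsupp : Function.support (fun x => g x • u₀ x) ⊆ tsupport g := by
      intro y hy
      have hgy : g y ≠ 0 := by
        intro h0
        exact hy (by simp [h0])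
      exact subset_tsupport g (Function.mem_support.2 hgy)
    rw [← integrableOn_iff_integrable_of_support_subset hsupp]
    refine Measure.integrableOn_of_bounded (M := Cg * C) hgc.isCompact.measure_lt_top.ne
      (hg.continuous.aestronglyMeasurable.smul hu₀) ?_
    refine (ae_restrict_mem (isClosed_tsupport g).measurableSet).mono fun y hy => ?_
    have hu : ‖u₀ y‖ ≤ C := norm_slice_le_of_hasFinalSlice hsl hC hy (by simpa using hS (hgS hy))
    calc ‖g y • u₀ y‖ = ‖g y‖ * ‖u₀ y‖ := norm_smul _ _
      _ ≤ Cg * C := mul_le_mul (hCg y) hu (norm_nonneg _) ((norm_nonneg _).trans (hCg y))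
  refine integral_eq_zero_of_forall_integral_inner_eq_zero ℝ _ hGint fun c => ?_
  have htest : IsTestOn S (fun x => g x • c) := by
    refine ⟨hg.continuous.smul continuous_const, hgc.mono ?_, (tsupport_smul_subset_left g _).trans hgS⟩
    intro y hy
    have hgy : g y ≠ 0 := by
      intro h0
      exact hy (by simp [h0])
    exact Function.mem_support.2 hgy
  have h := hpair _ htest
  calc ∫ x, ⟪c, g x • u₀ x⟫ = ∫ x, ⟪u₀ x, g x • c⟫ := by
        congr 1
        ext x
        rw [real_inner_smul_right, real_inner_smul_right, real_inner_comm]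
    _ = 0 := h

/-! ### A–B instantiations (the terminal-layer package's standing hypotheses) -/

/-- For an enveloped A–B object with final slice `u₀`: slice bounded by `B` on a set off the origin
⇒ trace essentially bounded by `B` there. -/
theorem traceEssBddOn_of_hasFinalSlice_AB {M A : ℝ} {P : ℝ → (EuclideanSpace ℝ (Fin 3)) → ℝ} {H : ℝ → (EuclideanSpace ℝ (Fin 3)) → (EuclideanSpace ℝ (Fin 3)) →L[ℝ] (EuclideanSpace ℝ (Fin 3))}
    (hAB : ABTower M U P H) (hdec : HasTypeIDecay A U)
    (hsl : ∀ x : (EuclideanSpace ℝ (Fin 3)), x ≠ 0 → Tendsto (fun t : ℝ => U t x) (𝓝[<] (0 : ℝ)) (𝓝 (u₀ x)))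
    {S : Set (EuclideanSpace ℝ (Fin 3))} (hS : S ⊆ {0}ᶜ) {B : ℝ} (hB : ∀ x ∈ S, ‖u₀ x‖ ≤ B) : TraceEssBddOn U S B :=
  traceEssBddOn_of_hasFinalSlice_bdd hS hsl (eventually_aestronglyMeasurable_of_abTower hAB)
    ((slicesLocallyBddOn_of_hasTypeIDecay hdec).mono hS) (ae_of_all _ fun x hx => hB x hx)

/-- … slice vanishing on a set off the origin ⇒ zero trace there. -/
theorem hasZeroTraceOn_of_hasFinalSlice_AB {M A : ℝ} {P : ℝ → (EuclideanSpace ℝ (Fin 3)) → ℝ} {H : ℝ → (EuclideanSpace ℝ (Fin 3)) → (EuclideanSpace ℝ (Fin 3)) →L[ℝ] (EuclideanSpace ℝ (Fin 3))}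
    (hAB : ABTower M U P H) (hdec : HasTypeIDecay A U)
    (hsl : ∀ x : (EuclideanSpace ℝ (Fin 3)), x ≠ 0 → Tendsto (fun t : ℝ => U t x) (𝓝[<] (0 : ℝ)) (𝓝 (u₀ x)))
    {S : Set (EuclideanSpace ℝ (Fin 3))} (hS : S ⊆ {0}ᶜ) (h0 : ∀ x ∈ S, u₀ x = 0) : HasZeroTraceOn U S :=
  hasZeroTraceOn_of_hasFinalSlice_ae_zero hS hsl (eventually_aestronglyMeasurable_of_abTower hAB)
    ((slicesLocallyBddOn_of_hasTypeIDecay hdec).mono hS) (ae_of_all _ fun x hx => h0 x hx)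

/-- … and conversely zero trace on an open set off the origin ⇒ slice `= 0` a.e. there. -/
theorem hasFinalSlice_ae_zero_of_hasZeroTraceOn_AB {M A : ℝ} {P : ℝ → (EuclideanSpace ℝ (Fin 3)) → ℝ}
    {H : ℝ → (EuclideanSpace ℝ (Fin 3)) → (EuclideanSpace ℝ (Fin 3)) →L[ℝ] (EuclideanSpace ℝ (Fin 3))} (hAB : ABTower M U P H) (hdec : HasTypeIDecay A U)
    (hsl : ∀ x : (EuclideanSpace ℝ (Fin 3)), x ≠ 0 → Tendsto (fun t : ℝ => U t x) (𝓝[<] (0 : ℝ)) (𝓝 (u₀ x)))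
    {S : Set (EuclideanSpace ℝ (Fin 3))} (hSo : IsOpen S) (hS : S ⊆ {0}ᶜ) (hz : HasZeroTraceOn U S) :
    ∀ᵐ x ∂(volume : Measure (EuclideanSpace ℝ (Fin 3))), x ∈ S → u₀ x = 0 :=
  hasFinalSlice_ae_zero_of_hasZeroTraceOn hSo hS hsl (eventually_aestronglyMeasurable_of_abTower hAB)
    ((slicesLocallyBddOn_of_hasTypeIDecay hdec).mono hS) hz

end Bridge

end Summit.NavierStokesRegularity.NavierStokesRegularity.Cruxes.ScarEnvelopeTypeI.FinalTrace
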